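import Literature.AlgebraicGeometry.Resolution.MonomializationAlongValuation
import Literature.AlgebraicGeometry.Resolution.StalkHeightBasicOpenIsoLocus
import HarnessLib

/-!
# Monomialization of one element along a valuation, scheme step, WITH contracted heights off `V(a)`

Topic: `Literature/AlgebraicGeometry/Resolution`. PROOF side of `CossartPiltant2019ReductionP`
(`ArithmeticalThreefoldsLocal.lean`), input (C4), [CoP1] Prop. 8.1 (1) (V. Cossart,
O. Piltant, HAL hal-00139124, p. 22): "there exists a local uniformization `S₂` of `(K/k, v)`
such that `S₁ < S₂`, `(S₁)_f = (S₂)_f` and `f S₂` is monomial". The scheme step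
`exists_fg_regular_monomial_of_isStrictNormalCrossingsDivisor_preimage`
(`MonomializationAlongValuation.lean`) produces, from a proper `π : X → Spec A` which is an
isomorphism over `D(a)` with `π⁻¹(V(a))` a strict normal crossings divisor (Cossart–Jannsen–Saito,
Cor. 1.5) and a valuation ring `O ⊇ A` with `v(a) > 0`, a finitely generated `T ⊆ O`, regular at
the centre `P`, in whose local ring `a` is a unit times a monomial. This file PROVES the same
statement TOGETHER WITH the algebraic shadow of "`(S₁)_f = (S₂)_f`" (an isomorphism off
`V(a)`): every prime `Q` of `T_P` not containing `a` contracts to a prime of `A` OF THE SAME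
HEIGHT (`exists_fg_regular_monomial_heights_of_isStrictNormalCrossingsDivisor_preimage`) —
`T_P ≅ 𝒪_{X,x′}`, the generization of `x′` with centre `Q` lies over `D(a)` where the stalk
maps of `π` are isomorphisms (`height_comap_stalkMap_eq_of_isIso_restrict_basicOpen`), and
`𝒪_{Spec A, π x′}` is a localization of `A`. Over a factorial `A` this is the input EXC of
`DenominatorsFromExceptionalLocus.lean` (height-one primes are principal).

Everything is PROVED; no named facts, definitions, instances or notation are introduced.

## Sources

* V. Cossart, O. Piltant, J. Algebra 320 (2008) 1051–1082, Prop. 4.1, Prop. 8.1 (1) (HAL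
  hal-00139124: pp. 6–7, 21–22). [CossartPiltant2008]
* V. Cossart, U. Jannsen, S. Saito, *Desingularization: Invariants and Strategy*, LNM 2270
  (2020), Cor. 1.5, p. 7. [CossartJannsenSaito2020]
* The Stacks Project, Tag 01J7. [StacksProject]
-/

noncomputable section

open CategoryTheory CategoryTheory.Limits AlgebraicGeometry TopologicalSpace IsLocalRing

namespace Literature.AlgebraicGeometry.Resolution

universe u

open Scheme.IdealSheafData

section Scheme

variable {A : Type u} [CommRing A] [IsDomain A] {K : Type u} [Field K] [Algebra A K]

set_option maxHeartbeats 1600000 in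
/-- **Monomialization of one function along a valuation, scheme step, with contracted
heights.** Let `π : X → Spec A` be proper and an isomorphism over `U = D(a)` (`a ≠ 0`), with
`π⁻¹(V(a))` a strict normal crossings divisor on `X`, and let `O ⊇ A` be a valuation ring of
`K = Frac A` with `v(a) < 1`. Then there is a finitely generated `A`-subalgebra `T ⊆ O` of `K`,
regular at the centre `P = 𝔪_O ∩ T`, with a regular system of parameters `z` of `T_P` in which
`a = u · ∏ zᵢ^{αᵢ}` (`u` a unit), AND such that every prime `Q ⊂ T_P` with `a ∉ Q` contracts
to a prime of `A` of the same height ("`(S₁)_a = (S₂)_a`": `T_P = 𝒪_{X,x′}` and `π` is an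
isomorphism at the generizations of `x′` off `V(a)`).
[cite: CossartPiltant2008, Prop. 4.1 and Prop. 8.1 (1) (HAL pp. 6–7, 21–22)]
[cite: CossartJannsenSaito2020, Cor. 1.5] -/
theorem exists_fg_regular_monomial_heights_of_isStrictNormalCrossingsDivisor_preimage
    (hAK : Function.Injective (algebraMap A K))
    (O : ValuationSubring K) (hAO : ∀ a : A, algebraMap A K a ∈ O) {X : Scheme.{u}}
    {π : X ⟶ Spec (.of A)} [IsProper π] (a : A) (ha : a ≠ 0)
    (haO : O.valuation (algebraMap A K a) < 1) (U : (Spec (.of A)).Opens)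
    (hU : ∀ p : PrimeSpectrum A, (p : Spec (.of A)) ∈ U ↔ a ∉ p.asIdeal) [IsIso (π ∣_ U)]
    (hsnc : IsStrictNormalCrossingsDivisor X
      (π.base ⁻¹' {p : Spec (.of A) | a ∈ (p : PrimeSpectrum A).asIdeal})) :
    ∃ (T : Subalgebra A K), T.toSubring ≤ O.toSubring ∧ T.FG ∧
      ∃ (P : Ideal T) (_ : P.IsPrime), (∀ t : T, t ∈ P ↔ O.valuation (t : K) < 1) ∧
        IsRegularLocalRing (Localization.AtPrime P) ∧
        (∀ Q : Ideal (Localization.AtPrime P), Q.IsPrime →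
          algebraMap A (Localization.AtPrime P) a ∉ Q →
          (Q.comap (algebraMap A (Localization.AtPrime P))).height = Q.height) ∧
        ∃ (d : ℕ) (z : Fin d → T) (α : Fin d → ℕ) (u : Localization.AtPrime P), IsUnit u ∧
          ringKrullDim (Localization.AtPrime P) = d ∧
          Ideal.span (Set.range fun i => algebraMap T (Localization.AtPrime P) (z i)) =
            IsLocalRing.maximalIdeal _ ∧
          algebraMap A (Localization.AtPrime P) a =
            u * ∏ i, (algebraMap T (Localization.AtPrime P) (z i)) ^ α i := by
  classical
  haveI : IsDomain (CommRingCat.of A) := ‹IsDomain A›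
  -- the ring maps `A → O → K`
  let φ₀ : A →+* O := (algebraMap A K).codRestrict O.toSubring hAO
  let ιOK : CommRingCat.of O ⟶ CommRingCat.of K := CommRingCat.ofHom (algebraMap O K)
  let i₂ : Spec (.of O) ⟶ Spec (.of A) := Spec.map (CommRingCat.ofHom φ₀)
  let g : Spec (.of K) ⟶ Spec (.of A) := Spec.map (CommRingCat.ofHom (algebraMap A K))
  have hg : Spec.map ιOK ≫ i₂ = g := by
    rw [← Spec.map_comp]
    rfl
  -- the generic point of `Spec A` lies in `U`
  let q : Spec (.of K) := closedPoint K
  have hgq : g q = (⊥ : PrimeSpectrum A) := by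
    change PrimeSpectrum.comap (algebraMap A K) (closedPoint K) = ⊥
    ext1
    rw [PrimeSpectrum.comap_asIdeal]
    change Ideal.comap (algebraMap A K) (maximalIdeal K) = ⊥
    rw [maximalIdeal_eq_bot, ← RingHom.ker_eq_comap_bot, RingHom.ker_eq_bot_iff_eq_zero]
    intro a ha
    exact hAK (by rw [ha, map_zero])
  have hbotU : ((⊥ : PrimeSpectrum A) : Spec (.of A)) ∈ U := by
    rw [hU]
    intro h
    exact ha (by simpa using h)
  have hrange : Set.range g.base ⊆ Set.range U.ι.base := by
    rw [Scheme.Opens.range_ι]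
    rintro _ ⟨p, rfl⟩
    obtain rfl : p = q := Subsingleton.elim _ _
    rw [hgq]; exact hbotU
  let g₁ : Spec (.of K) ⟶ U := IsOpenImmersion.lift U.ι g hrange
  have hg₁ : g₁ ≫ U.ι = g := IsOpenImmersion.lift_fac _ _ _
  let j : ↑(π ⁻¹ᵁ U) ⟶ X := (π ⁻¹ᵁ U).ι
  let i₁ : Spec (.of K) ⟶ X := g₁ ≫ inv (π ∣_ U) ≫ j
  have hsq : i₁ ≫ π = Spec.map ιOK ≫ i₂ := by
    rw [hg]
    simp only [i₁, j, Category.assoc, ← morphismRestrict_ι, IsIso.inv_hom_id_assoc, hg₁]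
  -- valuative criterion of properness
  have hex : ValuativeCriterion.Existence π := by
    have h := (inferInstance : UniversallyClosed π)
    rw [UniversallyClosed.eq_valuativeCriterion] at h
    exact h.1
  obtain ⟨l, hl₁, hl₂⟩ :=
    (hex { R := O, K := K, i₁ := i₁, i₂ := i₂, commSq := ⟨hsq⟩ }).exists_lift
  -- the centre `x' = l(𝔪_O)` lies on the divisor `π⁻¹(V(a))`
  set c : Spec (.of O) := closedPoint O with hc
  have hπlc : π.base (l.base c) = i₂.base c := by
    have h := congrArg (fun f : Spec (.of O) ⟶ Spec (.of A) => f.base c) hl₂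
    exact h
  have hmem : l.base c ∈ π.base ⁻¹' {p : Spec (.of A) | a ∈ (p : PrimeSpectrum A).asIdeal} := by
    rw [Set.mem_preimage, Set.mem_setOf_eq, hπlc]
    change a ∈ (PrimeSpectrum.comap φ₀ (closedPoint O)).asIdeal
    rw [PrimeSpectrum.comap_asIdeal, Ideal.mem_comap]
    change φ₀ a ∈ maximalIdeal O
    rw [ValuationSubring.valuation_lt_one_iff]
    exact haO
  obtain ⟨hregx, r, e, xs, ys, -, hdim, hspan, hvan⟩ := hsnc.2 _ hmem
  haveI := hregx
  haveI : IsDomain (X.presheaf.stalk (l.base c)) := Matsumura1987_14_3_holds _ hregx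
  let ψ := Scheme.stalkClosedPointTo l
  -- `ψ : 𝒪_{X,x'} → O` is injective
  have hψ : Function.Injective ψ := by
    let γ₀ : Spec (.of O) := Spec.map ιOK q
    have hγc : γ₀ ⤳ c := IsLocalRing.specializes_closedPoint γ₀
    have hE1 : Function.Injective (l.stalkMap γ₀) := by
      have h1 : Function.Injective (g.stalkMap q) := by
        have hF : IsField ((Spec (.of A)).presheaf.stalk (g q)) := by
          refine isField_stalk_of_eq ?_ (Field.toIsField (Spec (.of A)).functionField)
          rw [genericPoint_eq_bot_of_affine, hgq]
        letI := hF.toField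
        exact RingHom.injective _
      have h2 : Function.Injective (g₁.stalkMap q) := by
        rw [← stalkMap_injective_congr hg₁, Scheme.Hom.stalkMap_comp] at h1
        exact Function.Injective.of_comp_right h1
          (ConcreteCategory.bijective_of_isIso (U.ι.stalkMap (g₁ q))).2
      have h3 : Function.Injective (i₁.stalkMap q) := by
        change Function.Injective ((g₁ ≫ inv (π ∣_ U) ≫ j).stalkMap q)
        rw [Scheme.Hom.stalkMap_comp]
        exact h2.comp (ConcreteCategory.bijective_of_isIso ((inv (π ∣_ U) ≫ j).stalkMap _)).1
      rw [← stalkMap_injective_congr hl₁, Scheme.Hom.stalkMap_comp] at h3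
      have h4 : Function.Injective ((Spec.map ιOK).stalkMap q ∘ l.stalkMap γ₀) := h3
      exact Function.Injective.of_comp h4
    have hE2 := stalkSpecializes_injective_of_isDomain (l.base.hom.map_specializes hγc)
    have hE := Scheme.Hom.stalkSpecializes_stalkMap l γ₀ c hγc
    have hcomp : Function.Injective
        (l.stalkMap c ≫ (Spec (.of O)).presheaf.stalkSpecializes hγc) := by
      rw [← hE, CategoryTheory.hom_comp]
      exact hE1.comp hE2
    rw [CategoryTheory.hom_comp] at hcomp
    have hl : Function.Injective (l.stalkMap c) := Function.Injective.of_comp hcomp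
    change Function.Injective (l.stalkMap c ≫ (stalkClosedPointIso (.of O)).hom)
    rw [CategoryTheory.hom_comp]
    exact (ConcreteCategory.bijective_of_isIso (stalkClosedPointIso (.of O)).hom).1.comp hl
  -- an affine neighbourhood `V ∋ x'`, of finite type over `A`
  obtain ⟨_, ⟨V, hV, rfl⟩, hxV, -⟩ :=
    X.isBasis_affineOpens.exists_subset_of_mem_open (Set.mem_univ (l c)) isOpen_univ
  have hft : (π.appLE ⊤ V le_top).hom.FiniteType :=
    HasRingHomProperty.appLE (P := @LocallyOfFiniteType) π inferInstance ⟨⊤, isAffineOpen_top _⟩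
      ⟨V, hV⟩ le_top
  let α : A →+* Γ(X, V) := (π.appLE ⊤ V le_top).hom.comp (Scheme.ΓSpecIso (.of A)).inv.hom
  have hα : α.FiniteType :=
    hft.comp (RingHom.FiniteType.of_surjective _
      (Scheme.ΓSpecIso (.of A)).symm.commRingCatIsoToRingEquiv.surjective)
  let β : Γ(X, V) →+* O := ψ.hom.comp (X.presheaf.germ V (l c) hxV).hom
  -- compatibility `β ∘ α = (A → O)`
  have key1 : π.appLE ⊤ V le_top ≫ X.presheaf.germ V (l c) hxV =
      (Spec (.of A)).presheaf.germ ⊤ (π (l c)) trivial ≫ π.stalkMap (l c) := by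
    rw [Scheme.Hom.germ_stalkMap, Scheme.Hom.appLE, Category.assoc, TopCat.Presheaf.germ_res]
  have key2 : (Spec (.of A)).presheaf.germ ⊤ ((l ≫ π) c) trivial ≫
      Scheme.stalkClosedPointTo (l ≫ π) = (Scheme.ΓSpecIso (.of A)).hom ≫ CommRingCat.ofHom φ₀ := by
    rw [germ_stalkClosedPointTo_congr hl₂ ⊤ trivial]
    exact Scheme.germ_stalkClosedPointTo_Spec (CommRingCat.ofHom φ₀)
  have key3 : (Spec (.of A)).presheaf.germ ⊤ (π (l c)) trivial ≫ π.stalkMap (l c) ≫ ψ =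
      (Scheme.ΓSpecIso (.of A)).hom ≫ CommRingCat.ofHom φ₀ := by
    rw [← key2, Scheme.stalkClosedPointTo_comp]
    rfl
  have key : (Scheme.ΓSpecIso (.of A)).inv ≫ π.appLE ⊤ V le_top ≫
      X.presheaf.germ V (l c) hxV ≫ ψ = CommRingCat.ofHom φ₀ := by
    rw [← Category.assoc (π.appLE ⊤ V le_top), key1, Category.assoc, key3, Iso.inv_hom_id_assoc]
  have hβα : ∀ a, β (α a) = φ₀ a := fun a => by
    have := ConcreteCategory.congr_hom key a
    simp only [CategoryTheory.comp_apply, CommRingCat.hom_ofHom] at this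
    exact this
  -- the prime of `Γ(X, V)` at `x'` is the preimage of `𝔪_O`
  letI algx := X.presheaf.algebra_section_stalk (⟨l c, hxV⟩ : V)
  have hlocx := hV.isLocalization_stalk ⟨l c, hxV⟩
  set 𝔮 := (hV.primeIdealOf ⟨l c, hxV⟩).asIdeal with h𝔮def
  have h𝔮 : 𝔮 = Ideal.comap β (maximalIdeal O) := by
    rw [h𝔮def, IsAffineOpen.primeIdealOf_eq_map_closedPoint, Spec.map_apply,
      PrimeSpectrum.comap_asIdeal]
    change Ideal.comap (X.presheaf.germ V (l c) hxV).hom (maximalIdeal _) =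
      Ideal.comap (ψ.hom.comp (X.presheaf.germ V (l c) hxV).hom) (maximalIdeal O)
    rw [← Ideal.comap_comap, IsLocalRing.maximalIdeal_comap ψ.hom]
  -- the uniformizing algebra `T = image of Γ(X, V)` in `K`
  letI : Algebra A Γ(X, V) := α.toAlgebra
  haveI : Algebra.FiniteType A Γ(X, V) := hα
  let γ : Γ(X, V) →ₐ[A] K :=
    { (algebraMap O K).comp β with
      commutes' := fun a => by
        change algebraMap O K (β (α a)) = algebraMap A K a
        rw [hβα]; rfl }
  let T : Subalgebra A K := γ.range
  have hTfg : T.FG := by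
    change (γ.range).FG
    rw [← Algebra.map_top]; exact Subalgebra.FG.map _ Algebra.FiniteType.out
  have hTO : T.toSubring ≤ O.toSubring := by
    rintro _ ⟨b, rfl⟩; exact (β b).2
  set P : Ideal T := Ideal.comap (Subring.inclusion hTO) (maximalIdeal O) with hP
  let γ' : Γ(X, V) →+* T := γ.rangeRestrict.toRingHom
  have hγ' : ∀ b, ((γ' b : T) : K) = (β b : K) := fun b => rfl
  have hγ'sur : Function.Surjective γ' := AlgHom.rangeRestrict_surjective γ
  have hPq : Ideal.comap γ' P = 𝔮 := by
    ext b
    rw [h𝔮]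
    change Subring.inclusion hTO (γ' b) ∈ maximalIdeal O ↔ β b ∈ maximalIdeal O
    rw [show Subring.inclusion hTO (γ' b) = β b from Subtype.ext rfl]
  have hMle : 𝔮.primeCompl ≤ P.primeCompl.comap γ' := fun b hb hb' => hb (by
    rw [← hPq]; exact hb')
  let δ : X.presheaf.stalk (l c) →+* Localization.AtPrime P :=
    IsLocalization.map (Localization.AtPrime P) γ' hMle
  have hδsurj : Function.Surjective δ := by
    intro z
    obtain ⟨t, u, rfl⟩ := IsLocalization.exists_mk'_eq P.primeCompl z
    obtain ⟨b, rfl⟩ := hγ'sur t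
    obtain ⟨s, hs⟩ := hγ'sur u
    have hsq : s ∉ 𝔮 := by
      intro hs𝔮
      rw [← hPq, Ideal.mem_comap, hs] at hs𝔮
      exact u.2 hs𝔮
    refine ⟨IsLocalization.mk' _ b (⟨s, hsq⟩ : 𝔮.primeCompl), ?_⟩
    rw [IsLocalization.map_mk']
    congr 1
    exact Subtype.ext hs
  have hδinj : Function.Injective δ := by
    rw [injective_iff_map_eq_zero]
    intro z hz
    obtain ⟨b, s, rfl⟩ := IsLocalization.exists_mk'_eq 𝔮.primeCompl z
    rw [IsLocalization.map_mk', IsLocalization.mk'_eq_zero_iff] at hz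
    obtain ⟨⟨m, hm⟩, hmb⟩ := hz
    have hm0 : m ≠ 0 := fun h => hm (by rw [h]; exact P.zero_mem)
    have hb0 : γ' b = 0 := (mul_eq_zero.mp hmb).resolve_left hm0
    have hβb : β b = 0 := by
      have h1 : ((γ' b : T) : K) = 0 := by rw [hb0]; rfl
      rw [hγ'] at h1
      exact_mod_cast h1
    have hgerm : X.presheaf.germ V (l c) hxV b = 0 :=
      hψ (by rw [map_zero]; exact hβb)
    rw [IsLocalization.mk'_eq_mul_mk'_one]
    change X.presheaf.germ V (l c) hxV b * _ = 0
    rw [hgerm, zero_mul]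
  have hreg : IsRegularLocalRing (Localization.AtPrime P) :=
    IsRegularLocalRing.of_ringEquiv (RingEquiv.ofBijective δ ⟨hδinj, hδsurj⟩)
  have hP' : ∀ t : T, t ∈ P ↔ O.valuation (t : K) < 1 := fun t => by
    rw [hP]
    change Subring.inclusion hTO t ∈ maximalIdeal O ↔ _
    rw [ValuationSubring.valuation_lt_one_iff]
    rfl
  haveI : P.IsPrime := Ideal.IsPrime.comap _
  /- the ideal `√(a)` of the reduced preimage of `V(a)`, on `V` and in the stalk -/
  let J : X.IdealSheafData := (ofIdealTop (Ideal.span {(Scheme.ΓSpecIso (.of A)).inv a})).comap π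
  have hJsupp : (J.support : Set X) =
      π.base ⁻¹' {p : Spec (.of A) | a ∈ (p : PrimeSpectrum A).asIdeal} := by
    rw [support_comap, TopologicalSpace.Closeds.coe_preimage, coe_support_ofIdealTop,
      Scheme.zeroLocus_span, ← Set.image_singleton, Spec_zeroLocus_eq_zeroLocus]
    congr 1
    ext p
    rw [PrimeSpectrum.mem_zeroLocus, Set.singleton_subset_iff]
    rfl
  have hVle : (V : X.Opens) ≤ π ⁻¹ᵁ ((⟨⊤, isAffineOpen_top _⟩ : (Spec (.of A)).affineOpens) :
      (Spec (.of A)).Opens) := fun _ _ => trivial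
  have hJV : J.ideal ⟨V, hV⟩ = Ideal.span {α a} := by
    change ((ofIdealTop _).comap π).ideal ⟨V, hV⟩ = _
    rw [ideal_comap_eq_map_of_le π _ ⟨⊤, isAffineOpen_top _⟩ ⟨V, hV⟩ hVle,
      Scheme.IdealSheafData.ofIdealTop_ideal, Ideal.map_map, Ideal.map_span, Set.image_singleton]
    congr 1
  have hsuppEq : J.support = ⟨closure (π.base ⁻¹' {p : Spec (.of A) |
      a ∈ (p : PrimeSpectrum A).asIdeal}), isClosed_closure⟩ := by
    ext1
    rw [hJsupp]
    exact (hsnc.1.closure_eq).symm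
  have hvanV : (vanishingIdeal ⟨closure (π.base ⁻¹' {p : Spec (.of A) |
      a ∈ (p : PrimeSpectrum A).asIdeal}), isClosed_closure⟩).ideal ⟨V, hV⟩ =
      (Ideal.span {α a}).radical := by
    rw [← hsuppEq, vanishingIdeal_support, Scheme.IdealSheafData.radical_ideal, hJV]
  -- in the stalk: `√(a) = (∏ xᵢ)`
  let g₀ : Γ(X, V) →+* X.presheaf.stalk (l c) := (X.presheaf.germ V (l c) hxV).hom
  have hg₀alg : algebraMap Γ(X, V) (X.presheaf.stalk (l c)) = g₀ := rfl
  have hradstalk : (Ideal.span {g₀ (α a)}).radical = Ideal.span {∏ i, xs i} := by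
    have h1 := hvan ⟨V, hV⟩ hxV
    rw [hvanV] at h1
    rw [← h1]
    change _ = ((Ideal.span {α a}).radical).map (algebraMap Γ(X, V) (X.presheaf.stalk (l c)))
    rw [IsLocalization.map_radical 𝔮.primeCompl (X.presheaf.stalk (l c)), Ideal.map_span,
      Set.image_singleton, hg₀alg]
  /- rescale the parameters to germs of sections on `V` -/
  have hsurj := fun z : X.presheaf.stalk (l c) => IsLocalization.surj 𝔮.primeCompl z
  choose nd hnd using hsurj
  let num : X.presheaf.stalk (l c) → Γ(X, V) := fun z => (nd z).1
  let den : X.presheaf.stalk (l c) → 𝔮.primeCompl := fun z => (nd z).2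
  let xs' : Fin r → X.presheaf.stalk (l c) := fun i => g₀ (num (xs i))
  let ys' : Fin e → X.presheaf.stalk (l c) := fun j => g₀ (num (ys j))
  have hass : ∀ z : X.presheaf.stalk (l c), Associated z (g₀ (num z)) := fun z => by
    obtain ⟨w, hw⟩ := IsLocalization.map_units (X.presheaf.stalk (l c)) (den z)
    refine ⟨w, ?_⟩
    rw [hw, hg₀alg.symm]
    exact hnd z
  have hspan' : Ideal.span (Set.range xs' ∪ Set.range ys') = maximalIdeal _ := by
    rw [← hspan, Ideal.span_union, Ideal.span_union,
      span_range_eq_of_associated xs xs' (fun i => hass (xs i)),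
      span_range_eq_of_associated ys ys' (fun j => hass (ys j))]
  have hrad' : ∏ i, xs' i ∈ (Ideal.span {g₀ (α a)}).radical := by
    have h1 : ∀ i, ∃ w : X.presheaf.stalk (l c), xs' i = xs i * w := fun i => by
      obtain ⟨w, hw⟩ := hass (xs i)
      exact ⟨w, hw.symm⟩
    choose w hw using h1
    have h2 : ∏ i, xs' i = (∏ i, xs i) * ∏ i, w i := by
      rw [← Finset.prod_mul_distrib]
      exact Finset.prod_congr rfl fun i _ => hw i
    rw [h2]
    refine Ideal.mul_mem_right _ _ ?_
    rw [hradstalk]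
    exact Ideal.mem_span_singleton_self _
  -- `a ≠ 0` in the stalk
  have hψg₀ : ∀ z, ψ (g₀ z) = β z := fun z => rfl
  have hga0 : g₀ (α a) ≠ 0 := by
    intro h0
    have h1 : ((β (α a) : O) : K) = 0 := by rw [← hψg₀, h0, map_zero]; rfl
    rw [hβα] at h1
    exact ha (hAK (by rw [map_zero]; exact h1))
  -- monomial form in the stalk
  obtain ⟨u, αx, hu, hfact⟩ := exists_isUnit_mul_prod_pow_of_prod_mem_radical xs' ys' hdim hspan'
    (g₀ (α a)) hga0 hrad'
  /- transport through `δ : 𝒪_{X,x'} ≅ T_P` -/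
  have hδg : ∀ z, δ (g₀ z) = algebraMap T (Localization.AtPrime P) (γ' z) := fun z =>
    IsLocalization.map_eq hMle z
  let eδ : X.presheaf.stalk (l c) ≃+* Localization.AtPrime P := RingEquiv.ofBijective δ ⟨hδinj, hδsurj⟩
  have heδ : (eδ : X.presheaf.stalk (l c) →+* Localization.AtPrime P) = δ := RingHom.ext fun _ => rfl
  have hmapmax : Ideal.map δ (maximalIdeal _) = maximalIdeal (Localization.AtPrime P) := by
    apply le_antisymm
    · rw [Ideal.map_le_iff_le_comap]
      intro x hx
      rw [Ideal.mem_comap, IsLocalRing.mem_maximalIdeal, mem_nonunits_iff]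
      intro hunit
      apply (IsLocalRing.mem_maximalIdeal _).mp hx
      obtain ⟨v, hv⟩ := hunit.exists_right_inv
      obtain ⟨x', rfl⟩ := hδsurj v
      rw [← map_mul, ← map_one δ] at hv
      exact IsUnit.of_mul_eq_one _ (hδinj hv)
    · intro y hy
      obtain ⟨x, rfl⟩ := hδsurj y
      refine Ideal.mem_map_of_mem _ ((IsLocalRing.mem_maximalIdeal _).mpr ?_)
      rw [mem_nonunits_iff]
      intro hunit
      exact (IsLocalRing.mem_maximalIdeal _).mp hy (hunit.map δ)
  -- the parameters `z = (x', y')` read in `T`, indexed by `Fin (r + e)`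
  let zT : Fin r ⊕ Fin e → T := Sum.elim (fun i => γ' (num (xs i))) (fun j => γ' (num (ys j)))
  let z : Fin (r + e) → T := zT ∘ finSumFinEquiv.symm
  let αz : Fin (r + e) → ℕ := (Sum.elim αx (fun _ => 0)) ∘ finSumFinEquiv.symm
  have hγ'a : γ' (α a) = algebraMap A T a := by
    apply Subtype.ext
    rw [hγ', hβα, Subalgebra.coe_algebraMap]
    rfl
  /- contracted heights off `V(a)`: `T_P ≅ 𝒪_{X,x'}` and `π` is an isomorphism over `D(a)` -/
  have hγ'A : ∀ a' : A, γ' (α a') = algebraMap A T a' := fun a' => by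
    apply Subtype.ext
    rw [hγ', hβα, Subalgebra.coe_algebraMap]
    rfl
  have hAδ : ∀ a' : A, algebraMap A (Localization.AtPrime P) a' = δ (g₀ (α a')) := fun a' => by
    rw [hδg, hγ'A, ← IsScalarTower.algebraMap_apply]
  let sA : A → Γ(Spec (.of A), ⊤) := fun a' => (Scheme.ΓSpecIso (.of A)).inv a'
  have hg₀α : ∀ a' : A, g₀ (α a') = X.presheaf.germ ⊤ (l c) trivial (π.app ⊤ (sA a')) := by
    intro a'
    have h2 := ConcreteCategory.congr_hom key1 (sA a')
    have h3 := ConcreteCategory.congr_hom (Scheme.Hom.germ_stalkMap π ⊤ (l c) trivial) (sA a')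
    simp only [CategoryTheory.comp_apply] at h2 h3
    exact h2.trans h3
  have hUeq : U = (Spec (.of A)).basicOpen (sA a) := by
    rw [basicOpen_eq_of_affine]
    refine TopologicalSpace.Opens.ext (Set.ext fun p => ?_)
    exact (hU p).trans (PrimeSpectrum.mem_basicOpen a p).symm
  haveI : IsIso (π ∣_ (Spec (.of A)).basicOpen (sA a)) := by rw [← hUeq]; infer_instance
  -- `𝒪_{Spec A, π x'}` is a localization of `Γ(Spec A) ≅ A`
  letI algp := (Spec (.of A)).presheaf.algebra_section_stalk
    (⟨π.base (l.base c), trivial⟩ : (⊤ : (Spec (.of A)).Opens))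
  have hlocp := (isAffineOpen_top (Spec (.of A))).isLocalization_stalk ⟨π.base (l.base c), trivial⟩
  let e₀ : A ≃+* Γ(Spec (.of A), ⊤) := (Scheme.ΓSpecIso (.of A)).symm.commRingCatIsoToRingEquiv
  have he₀ : ∀ a' : A, e₀ a' = sA a' := fun _ => rfl
  have hEXC : ∀ Q : Ideal (Localization.AtPrime P), Q.IsPrime →
      algebraMap A (Localization.AtPrime P) a ∉ Q →
      (Q.comap (algebraMap A (Localization.AtPrime P))).height = Q.height := by
    intro Q hQ haQ
    -- pull `Q` back to the stalk along `δ`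
    let 𝔓 : Ideal (X.presheaf.stalk (l c)) := Q.comap δ
    haveI : 𝔓.IsPrime := Ideal.IsPrime.comap _
    have hQ𝔓 : 𝔓.height = Q.height := by
      have h := RingEquiv.height_comap eδ Q
      have hEq : Q.comap eδ = 𝔓 := Ideal.ext fun _ => Iff.rfl
      rw [hEq] at h
      exact h
    have hgerm : X.presheaf.germ ⊤ (l c) trivial (π.app ⊤ (sA a)) ∉ 𝔓 := by
      rw [← hg₀α]
      intro hmem
      exact haQ (by rw [hAδ]; exact hmem)
    -- heights along `A ≅ Γ(Spec A) → 𝒪_{Spec A, π x'} → 𝒪_{X,x'} ≅ T_P`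
    have hA1 := height_comap_stalkMap_eq_of_isIso_restrict_basicOpen π (sA a) (l c) 𝔓 hgerm
    have hA2 : ((𝔓.comap (π.stalkMap (l c)).hom).comap
        (algebraMap Γ(Spec (.of A), ⊤) ((Spec (.of A)).presheaf.stalk (π.base (l.base c))))).height =
        (𝔓.comap (π.stalkMap (l c)).hom).height :=
      IsLocalization.height_under
        ((isAffineOpen_top (Spec (.of A))).primeIdealOf ⟨π.base (l.base c), trivial⟩).asIdeal.primeCompl _
    have hA3 := RingEquiv.height_comap e₀ ((𝔓.comap (π.stalkMap (l c)).hom).comap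
        (algebraMap Γ(Spec (.of A), ⊤) ((Spec (.of A)).presheaf.stalk (π.base (l.base c)))))
    have hEq : Q.comap (algebraMap A (Localization.AtPrime P)) =
        (((𝔓.comap (π.stalkMap (l c)).hom).comap
          (algebraMap Γ(Spec (.of A), ⊤) ((Spec (.of A)).presheaf.stalk (π.base (l.base c))))).comap
            e₀) := by
      ext a'
      simp only [Ideal.mem_comap]
      rw [hAδ a', hg₀α a', he₀]
      have h4 := ConcreteCategory.congr_hom (Scheme.Hom.germ_stalkMap π ⊤ (l c) trivial) (sA a')
      simp only [CategoryTheory.comp_apply] at h4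
      have h4' : (π.stalkMap (l c)).hom
          (((Spec (.of A)).presheaf.germ ⊤ (π.base (l.base c)) trivial).hom (sA a')) =
          (X.presheaf.germ ⊤ (l c) trivial).hom ((π.app ⊤).hom (sA a')) := h4
      rw [← h4']
      exact Iff.rfl
    rw [hEq, hA3, hA2, hA1, hQ𝔓]
  refine ⟨T, hTO, hTfg, P, inferInstance, hP', hreg, hEXC, r + e, z, αz, δ u, hu.map δ, ?_, ?_, ?_⟩
  · rw [← ringKrullDim_eq_of_ringEquiv eδ, hdim]
  · rw [← hmapmax, ← hspan', Ideal.map_span]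
    congr 1
    rw [Set.image_union, ← Set.range_comp, ← Set.range_comp]
    have hz : Set.range (fun i => algebraMap T (Localization.AtPrime P) (z i)) =
        Set.range (fun i => algebraMap T (Localization.AtPrime P) (zT i)) := by
      rw [show (fun i => algebraMap T (Localization.AtPrime P) (z i)) =
        (fun i => algebraMap T (Localization.AtPrime P) (zT i)) ∘ finSumFinEquiv.symm from rfl]
      exact (finSumFinEquiv.symm.surjective).range_comp _
    rw [hz, show (fun i => algebraMap T (Localization.AtPrime P) (zT i)) =
      Sum.elim (fun i => algebraMap T (Localization.AtPrime P) (γ' (num (xs i))))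
        (fun j => algebraMap T (Localization.AtPrime P) (γ' (num (ys j)))) from
        funext fun i => by rcases i with i | j <;> rfl, Set.Sum.elim_range]
    congr 1
    · ext w
      simp only [Set.mem_range, Function.comp_apply]
      exact exists_congr fun i => by rw [show δ (xs' i) = δ (g₀ (num (xs i))) from rfl, hδg]
    · ext w
      simp only [Set.mem_range, Function.comp_apply]
      exact exists_congr fun j => by rw [show δ (ys' j) = δ (g₀ (num (ys j))) from rfl, hδg]
  · have h1 : algebraMap A (Localization.AtPrime P) a = δ (g₀ (α a)) := by
      rw [hδg, hγ'a, ← IsScalarTower.algebraMap_apply]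
    rw [h1, hfact, map_mul, map_prod]
    congr 1
    have hR : ∏ i, algebraMap T (Localization.AtPrime P) (z i) ^ αz i =
        ∏ i, algebraMap T (Localization.AtPrime P) (zT i) ^ (Sum.elim αx (fun _ => 0)) i :=
      Fintype.prod_equiv finSumFinEquiv.symm _ _ (fun _ => rfl)
    rw [hR, Fintype.prod_sum_type]
    simp only [zT, Sum.elim_inl, Sum.elim_inr, pow_zero, Finset.prod_const_one, mul_one]
    exact Finset.prod_congr rfl fun i _ => by
      rw [map_pow, show δ (xs' i) = δ (g₀ (num (xs i))) from rfl, hδg]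

end Scheme

end Literature.AlgebraicGeometry.Resolution

end
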